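import Literature.NumberTheory.Sieve.LevelOfDistribution
import Literature.NumberTheory.LFunctions.PagePNTWithExceptionalZeroProofs
import Literature.NumberTheory.Sieve.MoebiusCoprimeProgressions
import Literature.NumberTheory.LFunctions.SiegelWalfiszMoebiusProofs
import HarnessLib

/-!
# `μ` on an interval as a coefficient sequence for `GEH[ϑ]` — the Siegel–Walfisz hypothesis

Trunk AntSieve, tooling toward the named fact `Literature.NumberTheory.Sieve.weakDHL_three_two_of_GEH`
(D. H. J. Polymath, Res. Math. Sci. 1:12 (2014) = arXiv:1407.4897, Theorem 3.2(xii)).  Companion of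
`Literature.NumberTheory.Sieve.vonMangoldtPiece_siegelWalfisz_hypothesis`: in the deduction of
`EH[ϑ]` from `GEH[ϑ]` (Proposition 2.7, p. 7, "Vaughan's identity") the pieces of Vaughan's identity
carry a factor `Λ` or a factor `μ` on a short interval, and Claim 2.6 is applied with that factor as
`β`; its Siegel–Walfisz hypothesis (2.4) for `β = μ · 1_{(m,m']}` is the Siegel–Walfisz theorem for the
Möbius function with a coprimality condition, available in the tree as
`Literature.NumberTheory.LFunctions.SiegelWalfiszMoebius.sum_coprime_progression_le` (from
`Literature.NumberTheory.LFunctions.SiegelWalfiszMoebius_holds`).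

* `moebiusPiece m m'` — `μ · 1_{(m, m']}` as an `ArithmeticFunction ℝ`;
* `moebiusPiece_siegelWalfisz_hypothesis` — hypothesis (2.4) for it, with `τ(qr)^k`, `k ≥ 2`
  (`4^{ω(qr)} ≤ τ(qr)²`).

## References

* [Polymath8b2014] D. H. J. Polymath, Res. Math. Sci. 1 (2014), Art. 12 = arXiv:1407.4897,
  Claim 2.6 (2.4) (p. 6), Proposition 2.7 (p. 7).
* [MontgomeryVaughan2007] H. L. Montgomery, R. C. Vaughan, *Multiplicative Number Theory I*,
  §11.3 (Siegel–Walfisz for `μ`).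
-/

noncomputable section

open Finset Real
open scoped ArithmeticFunction.Moebius ArithmeticFunction.omega ArithmeticFunction.sigma

namespace Literature.NumberTheory.Sieve

/-! ### The piece `μ · 1_{(m, m']}` -/

/-- `μ · 1_{(m, m']}`: the Möbius function restricted to an interval with natural endpoints, as a
real arithmetic function. [cite: Polymath8b2014, Proposition 2.7] -/
def moebiusPiece (m m' : ℕ) : ArithmeticFunction ℝ :=
  ⟨fun n => if m < n ∧ n ≤ m' then (μ n : ℝ) else 0, by simp⟩

/-- Values of the piece. [folklore] -/
theorem moebiusPiece_apply (m m' n : ℕ) :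
    moebiusPiece m m' n = if m < n ∧ n ≤ m' then (μ n : ℝ) else 0 := rfl

/-- `|μ-piece| ≤ 1`. [folklore] -/
theorem abs_moebiusPiece_le (m m' n : ℕ) : |moebiusPiece m m' n| ≤ 1 := by
  rw [moebiusPiece_apply]
  split_ifs
  · have := ArithmeticFunction.abs_moebius_le_one (n := n)
    exact_mod_cast this
  · simp

/-- **Restricting a filtered sum of the piece to its interval**: for `N ≥ m'` and any predicate `p`,
`Σ_{n ∈ [1,N], p n} (μ 1_{(m,m']})(n) = Σ_{n ∈ (m, m'], p n} μ(n)`. [folklore] -/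
theorem sum_filter_moebiusPiece {m m' N : ℕ} (hN : m' ≤ N) (p : ℕ → Prop) [DecidablePred p] :
    ∑ n ∈ (Icc 1 N).filter p, moebiusPiece m m' n = ∑ n ∈ (Ioc m m').filter p, (μ n : ℝ) := by
  have hsub : (Ioc m m').filter p ⊆ (Icc 1 N).filter p := by
    refine Finset.filter_subset_filter p fun n hn => ?_
    rw [Finset.mem_Ioc] at hn
    rw [Finset.mem_Icc]
    omega
  rw [← Finset.sum_subset hsub]
  · refine Finset.sum_congr rfl fun n hn => ?_
    have hn' := (Finset.mem_filter.1 hn).1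
    rw [Finset.mem_Ioc] at hn'
    rw [moebiusPiece_apply, if_pos ⟨hn'.1, hn'.2⟩]
  · intro n hn hn'
    have hp : p n := (Finset.mem_filter.1 hn).2
    have hnot : n ∉ Ioc m m' := fun h => hn' (Finset.mem_filter.2 ⟨h, hp⟩)
    rw [Finset.mem_Ioc, not_and_or, not_lt, not_le] at hnot
    rw [moebiusPiece_apply, if_neg]
    rintro ⟨h1, h2⟩
    rcases hnot with h | h <;> omega

/-- A filtered sum over `(m, m']` is the difference of the filtered sums over `[1, m']` and `[1, m]`.
[folklore] -/
theorem sum_Ioc_filter_eq_sub {m m' : ℕ} (h : m ≤ m') (p : ℕ → Prop) [DecidablePred p] (f : ℕ → ℝ) :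
    ∑ n ∈ (Ioc m m').filter p, f n = ∑ n ∈ (Icc 1 m').filter p, f n - ∑ n ∈ (Icc 1 m).filter p, f n := by
  have hunion : (Icc 1 m').filter p = (Icc 1 m).filter p ∪ (Ioc m m').filter p := by
    rw [← Finset.filter_union]
    congr 1
    ext n
    simp only [Finset.mem_Icc, Finset.mem_union, Finset.mem_Ioc]
    omega
  have hdisj : Disjoint ((Icc 1 m).filter p) ((Ioc m m').filter p) := by
    rw [Finset.disjoint_left]
    intro n hn hn'
    have h1 := (Finset.mem_filter.1 hn).1
    have h2 := (Finset.mem_filter.1 hn').1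
    rw [Finset.mem_Icc] at h1
    rw [Finset.mem_Ioc] at h2
    omega
  rw [hunion, Finset.sum_union hdisj]
  ring

/-- `2^{ω(d)} ≤ τ(d)` (the squarefree divisors), hence `4^{ω(d)} ≤ τ(d)²`.  (Same argument as the
tree's `FriedlanderIwaniecPrimesSquarefree.two_pow_card_primeFactors_le_sigma`.) [folklore] -/
theorem four_pow_card_primeFactors_le_sigma_sq (d : ℕ) (hd : d ≠ 0) :
    (4 : ℝ) ^ d.primeFactors.card ≤ (σ 0 d : ℝ) ^ 2 := by
  have h2 : (2 : ℝ) ^ d.primeFactors.card ≤ σ 0 d := by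
    rw [ArithmeticFunction.sigma_zero_apply]
    suffices h : 2 ^ d.primeFactors.card ≤ #d.divisors by exact_mod_cast h
    rw [← Finset.card_powerset]
    have hinj : Set.InjOn (fun L : Finset ℕ => ∏ p ∈ L, p) ↑(d.primeFactors.powerset) := by
      intro L hL L' hL' h
      have hLp : ∀ p ∈ L, p.Prime := fun p hp => Nat.prime_of_mem_primeFactors (mem_powerset.mp hL hp)
      have hLp' : ∀ p ∈ L', p.Prime := fun p hp => Nat.prime_of_mem_primeFactors (mem_powerset.mp hL' hp)
      have := congrArg Nat.primeFactors h
      simp only at this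
      rwa [Nat.primeFactors_prod hLp, Nat.primeFactors_prod hLp'] at this
    have hmaps : ∀ L ∈ d.primeFactors.powerset, (∏ p ∈ L, p) ∈ d.divisors := by
      intro L hL
      rw [Nat.mem_divisors]
      refine ⟨?_, hd⟩
      calc ∏ p ∈ L, p ∣ ∏ p ∈ d.primeFactors, p := Finset.prod_dvd_prod_of_subset _ _ _ (mem_powerset.mp hL)
        _ ∣ d := Nat.prod_primeFactors_dvd d
    exact Finset.card_le_card_of_injOn _ hmaps hinj
  calc (4 : ℝ) ^ d.primeFactors.card = ((2 : ℝ) ^ d.primeFactors.card) ^ 2 := by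
        rw [← pow_mul, mul_comm, pow_mul]; norm_num
    _ ≤ (σ 0 d : ℝ) ^ 2 := pow_le_pow_left₀ (by positivity) h2 2


/-! ### The Siegel–Walfisz hypothesis (2.4) of Claim 2.6 for the pieces of `μ` -/

set_option maxHeartbeats 1600000 in
-- one long explicit-constant estimate (two cases, a dozen auxiliary inequalities)
open Filter in
/-- **Polymath 8b, Claim 2.6 (2.4) for `β = μ · 1_{(m,m']}`** — the Siegel–Walfisz hypothesis of
`GeneralizedElliottHalberstam` for the Möbius pieces used in Proposition 2.7.  Let
`m(x) ≤ m'(x) ≤ K m(x)` be natural scales with `m(x) ≥ x^{c₀}` and `m'(x) ≤ x` (eventually).  Then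
for every `B > 0` there is `C` with, eventually in `x`, for ALL `q, r ≥ 1` and primitive `a (q)`:
`|Δ((μ 1_{(m,m']}) 1_{(·,r)=1}; a (q))| ≤ C τ(qr)^k m / log^B x` (`k ≥ 2`).  Proof: for
`q ≤ (log m)^{2B+2}`, the Siegel–Walfisz theorem for `μ` with a coprimality condition
(`SiegelWalfiszMoebius.sum_coprime_progression_le`, from `SiegelWalfiszMoebius_holds`) at `m` and `m'`,
for the progression `a (q)` with `(n, r) = 1` and for the trivial progression with `(n, qr) = 1`,
and `4^{ω} ≤ τ²`; for larger `q` the trivial bounds `#{n ≤ y : n ≡ a (q)} ≤ y/q + 1`, `√q ≪ φ(q)`.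
[cite: Polymath8b2014, Claim 2.6 (2.4) and Proposition 2.7] -/
theorem moebiusPiece_siegelWalfisz_hypothesis {c₀ : ℝ} (hc₀ : 0 < c₀) (K : ℝ) (hK : 1 ≤ K)
    (m m' : ℝ → ℕ) (hm : ∀ᶠ x in atTop, x ^ c₀ ≤ m x) (hmm' : ∀ x, m x ≤ m' x)
    (hm'K : ∀ x, (m' x : ℝ) ≤ K * m x) (hm'x : ∀ᶠ x in atTop, (m' x : ℝ) ≤ x) (k : ℕ) (hk : 2 ≤ k)
    (B : ℝ) (hB : 0 < B) :
    ∃ C : ℝ, ∀ᶠ x in atTop, ∀ q r : ℕ, 1 ≤ q → 1 ≤ r → ∀ a : (ZMod q)ˣ,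
      |apDiscrepancy (fun n => if n.Coprime r then moebiusPiece (m x) (m' x) n else 0) ⌊K * (m x : ℝ)⌋₊ q a|
        ≤ C * (σ 0 (q * r) : ℝ) ^ k * m x / Real.log x ^ B := by
  -- constants
  set B' : ℝ := 2 * (B + 1) with hB'
  have hB'0 : 0 < B' := by rw [hB']; linarith
  obtain ⟨C₁, hC₁0, hC₁⟩ :=
    Literature.NumberTheory.LFunctions.SiegelWalfiszMoebius.sum_coprime_progression_le
      Literature.NumberTheory.LFunctions.SiegelWalfiszMoebius_holds hB'0 hB'0.le
  obtain ⟨C₃, hC₃1, hC₃⟩ := Literature.NumberTheory.LFunctions.PagePNT.exists_sqrt_le_mul_totient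
  refine ⟨4 * C₁ * K / c₀ ^ B' + (K / c₀ ^ B' + 1 + K * C₃ / c₀ ^ (B + 1)), ?_⟩
  have hK0 : (0 : ℝ) ≤ K := by linarith
  have hC₃0 : 0 ≤ C₃ := by linarith
  -- eventual conditions on `x`
  have e3 : ∀ᶠ x : ℝ in atTop, Real.exp 1 ≤ x ^ c₀ := (tendsto_rpow_atTop hc₀).eventually_ge_atTop _
  have e4 : ∀ᶠ x : ℝ in atTop, Real.log x ^ (B + 1) ≤ x ^ c₀ := by
    have := (isLittleO_log_rpow_rpow_atTop (B + 1) hc₀).bound (by norm_num : (0:ℝ) < 1)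
    filter_upwards [this, eventually_gt_atTop (1 : ℝ)] with x hx hx1
    rw [one_mul, Real.norm_eq_abs, Real.norm_eq_abs, abs_of_nonneg (Real.rpow_nonneg (Real.log_nonneg hx1.le) _),
      abs_of_nonneg (Real.rpow_nonneg (by linarith) _)] at hx
    exact hx
  have e5 : ∀ᶠ x : ℝ in atTop, Real.exp 1 ≤ x := eventually_ge_atTop _
  filter_upwards [hm, hm'x, e3, e4, e5] with x hmx hm'x hx3 hx4 hx5 q r hq hr a
  -- basic facts at this `x`
  have hx1 : 1 < x := lt_of_lt_of_le (by have := Real.add_one_le_exp (1:ℝ); linarith) hx5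
  have hx0 : 0 < x := by linarith
  have hlogx : 1 ≤ Real.log x := by rwa [Real.le_log_iff_exp_le hx0]
  have hlogx0 : 0 < Real.log x := by linarith
  have he2 : (2 : ℝ) ≤ Real.exp 1 := by have := Real.add_one_le_exp (1:ℝ); linarith
  have hme : Real.exp 1 ≤ (m x : ℝ) := hx3.trans hmx
  have hm2 : (2 : ℝ) ≤ m x := he2.trans hme
  have hm1 : (1 : ℝ) ≤ m x := by linarith
  have hm1n : 1 ≤ m x := by exact_mod_cast hm1
  have hmm'x := hmm' x
  have hm'1n : 1 ≤ m' x := le_trans hm1n hmm'x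
  have hm'1 : (1 : ℝ) ≤ m' x := by exact_mod_cast hm'1n
  have hm'2 : (2 : ℝ) ≤ m' x := le_trans hm2 (by exact_mod_cast hmm'x)
  have hmpos : (0 : ℝ) < m x := by linarith
  have hlogm : c₀ * Real.log x ≤ Real.log (m x) := by
    have h1 : Real.log (x ^ c₀) = c₀ * Real.log x := Real.log_rpow hx0 c₀
    rw [← h1]
    exact Real.log_le_log (Real.rpow_pos_of_pos hx0 _) hmx
  have hlogm' : c₀ * Real.log x ≤ Real.log (m' x) :=
    hlogm.trans (Real.log_le_log hmpos (by exact_mod_cast hmm'x))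
  have hc₀log : 0 < c₀ * Real.log x := mul_pos hc₀ hlogx0
  -- `τ(qr) ≥ 1`, `4^ω ≤ τ²`
  have hq0 : q ≠ 0 := by omega
  have hr0 : r ≠ 0 := by omega
  have hqr0 : q * r ≠ 0 := Nat.mul_ne_zero hq0 hr0
  have hτ1 : (1 : ℝ) ≤ (σ 0 (q * r) : ℝ) := by
    have : 1 ≤ σ 0 (q * r) := by
      rw [ArithmeticFunction.sigma_zero_apply]
      exact Finset.card_pos.2 ⟨1, Nat.one_mem_divisors.2 hqr0⟩
    exact_mod_cast this
  have hτk : (σ 0 (q * r) : ℝ) ^ 2 ≤ (σ 0 (q * r) : ℝ) ^ k := pow_le_pow_right₀ hτ1 hk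
  have h4qr : (4 : ℝ) ^ (q * r).primeFactors.card ≤ (σ 0 (q * r) : ℝ) ^ k :=
    (four_pow_card_primeFactors_le_sigma_sq (q * r) hqr0).trans hτk
  have h4r : (4 : ℝ) ^ r.primeFactors.card ≤ (σ 0 (q * r) : ℝ) ^ k := by
    refine le_trans ?_ h4qr
    refine pow_le_pow_right₀ (by norm_num) (Finset.card_le_card ?_)
    rw [Nat.primeFactors_mul hq0 hr0]
    exact Finset.subset_union_right
  -- the cut-off covers the piece
  have hN : m' x ≤ ⌊K * (m x : ℝ)⌋₊ := Nat.le_floor (hm'K x)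
  -- the two sums of the discrepancy
  haveI : NeZero q := ⟨hq0⟩
  obtain ⟨A1, hA1⟩ : ∃ v : ℝ, v = ∑ n ∈ (Icc 1 ⌊K * (m x : ℝ)⌋₊).filter (fun n : ℕ => (n : ZMod q) = a),
    (if n.Coprime r then moebiusPiece (m x) (m' x) n else 0) := ⟨_, rfl⟩
  obtain ⟨A2, hA2⟩ : ∃ v : ℝ, v = ∑ n ∈ (Icc 1 ⌊K * (m x : ℝ)⌋₊).filter (fun n : ℕ => n.Coprime q),
    (if n.Coprime r then moebiusPiece (m x) (m' x) n else 0) := ⟨_, rfl⟩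
  have hΔ : apDiscrepancy (fun n => if n.Coprime r then moebiusPiece (m x) (m' x) n else 0)
      ⌊K * (m x : ℝ)⌋₊ q a = A1 - A2 / Nat.totient q := by
    rw [hA1, hA2]; rfl
  have hA1' : A1 = ∑ n ∈ (Ioc (m x) (m' x)).filter (fun n : ℕ => (n : ZMod q) = a ∧ n.Coprime r), (μ n : ℝ) := by
    rw [hA1, ← Finset.sum_filter, Finset.filter_filter, sum_filter_moebiusPiece hN]
  have hA2' : A2 = ∑ n ∈ (Ioc (m x) (m' x)).filter
      (fun n : ℕ => (n : ZMod 1) = 0 ∧ n.Coprime (q * r)), (μ n : ℝ) := by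
    rw [hA2, ← Finset.sum_filter, Finset.filter_filter, sum_filter_moebiusPiece hN]
    refine Finset.sum_congr (Finset.filter_congr fun n _ => ?_) fun _ _ => rfl
    rw [Nat.coprime_mul_iff_right]
    simp only [eq_iff_true_of_subsingleton, true_and]
  -- `Y = m / log^B x`, rpow bookkeeping
  set Y : ℝ := m x / Real.log x ^ B with hYdef
  have hY0 : 0 ≤ Y := by rw [hYdef]; positivity
  set L₀ : ℝ := c₀ * Real.log x with hL₀def
  have hL₀ : 0 < L₀ := hc₀log
  have hlogBpos : 0 < Real.log x ^ B := Real.rpow_pos_of_pos hlogx0 B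
  have hlogB1pos : 0 < Real.log x ^ (B + 1) := Real.rpow_pos_of_pos hlogx0 _
  have hc₀B'pos : 0 < c₀ ^ B' := Real.rpow_pos_of_pos hc₀ _
  have hc₀B1pos : 0 < c₀ ^ (B + 1) := Real.rpow_pos_of_pos hc₀ _
  have hL₀B' : L₀ ^ B' = c₀ ^ B' * Real.log x ^ B' := by rw [hL₀def, Real.mul_rpow hc₀.le hlogx0.le]
  have hL₀B1 : L₀ ^ (B + 1) = c₀ ^ (B + 1) * Real.log x ^ (B + 1) := by
    rw [hL₀def, Real.mul_rpow hc₀.le hlogx0.le]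
  have hlogpowB1 : Real.log x * Real.log x ^ B = Real.log x ^ (B + 1) := by
    rw [Real.rpow_add hlogx0, Real.rpow_one, mul_comm]
  have AUX3 : m x / Real.log x ^ B' ≤ Y := by
    rw [hYdef]
    exact div_le_div_of_nonneg_left hmpos.le hlogBpos
      (Real.rpow_le_rpow_of_exponent_le hlogx (by rw [hB']; linarith))
  have AUX2 : m x / Real.log x ^ (B + 1) ≤ Y := by
    rw [hYdef]
    exact div_le_div_of_nonneg_left hmpos.le hlogBpos (Real.rpow_le_rpow_of_exponent_le hlogx (by linarith))
  have hfrac : ∀ y : ℝ, 0 ≤ y → y ≤ K * m x → L₀ ≤ Real.log y → y / Real.log y ^ B' ≤ K / c₀ ^ B' * Y := by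
    intro y hy0 hyK hyL
    have hpow : L₀ ^ B' ≤ Real.log y ^ B' := Real.rpow_le_rpow hL₀.le hyL hB'0.le
    have hL₀B'pos : 0 < L₀ ^ B' := Real.rpow_pos_of_pos hL₀ B'
    calc y / Real.log y ^ B' ≤ y / L₀ ^ B' := div_le_div_of_nonneg_left hy0 hL₀B'pos hpow
      _ ≤ K * m x / L₀ ^ B' := div_le_div_of_nonneg_right hyK hL₀B'pos.le
      _ = K / c₀ ^ B' * (m x / Real.log x ^ B') := by rw [hL₀B']; field_simp
      _ ≤ K / c₀ ^ B' * Y := mul_le_mul_of_nonneg_left AUX3 (div_nonneg hK0 hc₀B'pos.le)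
  have hm'Km : (m' x : ℝ) ≤ K * m x := hm'K x
  have hmKm : (m x : ℝ) ≤ K * m x := le_mul_of_one_le_left hmpos.le hK
  have hφ1 : (1 : ℝ) ≤ Nat.totient q := by exact_mod_cast Nat.totient_pos.2 (by omega)
  have hφ0 : (0 : ℝ) < Nat.totient q := by linarith
  -- the estimate `|A1| + |A2| / φ(q) ≤ C' Y`, then `Y ≤ X`
  have hYX : Y ≤ (σ 0 (q * r) : ℝ) ^ k * m x / Real.log x ^ B := by
    rw [hYdef, mul_div_assoc]
    exact le_mul_of_one_le_left (by positivity) (one_le_pow₀ hτ1)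
  have hbound : |A1| + |A2| / Nat.totient q ≤
      (4 * C₁ * K / c₀ ^ B' + (K / c₀ ^ B' + 1 + K * C₃ / c₀ ^ (B + 1))) *
        ((σ 0 (q * r) : ℝ) ^ k * m x / Real.log x ^ B) := by
    set X : ℝ := (σ 0 (q * r) : ℝ) ^ k * m x / Real.log x ^ B with hXdef
    have hX0 : 0 ≤ X := by rw [hXdef]; positivity
    have hτkX : (σ 0 (q * r) : ℝ) ^ k * Y = X := by rw [hXdef, hYdef, mul_div_assoc]
    have hlogm1 : 1 ≤ Real.log (m x) := by
      rw [Real.le_log_iff_exp_le hmpos]; exact hme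
    have hlogm'1 : 1 ≤ Real.log (m' x) := hlogm1.trans (Real.log_le_log hmpos (by exact_mod_cast hmm'x))
    have h1Y : 1 ≤ Y := by
      rw [hYdef, le_div_iff₀ hlogBpos, one_mul]
      have : Real.log x ^ B ≤ Real.log x ^ (B + 1) := Real.rpow_le_rpow_of_exponent_le hlogx (by linarith)
      exact this.trans (hx4.trans hmx)
    have hCY : (4 * C₁ * K / c₀ ^ B' + (K / c₀ ^ B' + 1 + K * C₃ / c₀ ^ (B + 1))) * X =
        4 * C₁ * K / c₀ ^ B' * X + (K / c₀ ^ B' * X + X + K * C₃ / c₀ ^ (B + 1) * X) := by ring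
    have hYX' : Y ≤ X := by rw [hXdef]; exact hYX
    have hKc : 0 ≤ K / c₀ ^ B' := div_nonneg hK0 hc₀B'pos.le
    have hKC₃c : 0 ≤ K * C₃ / c₀ ^ (B + 1) := div_nonneg (mul_nonneg hK0 hC₃0) hc₀B1pos.le
    have h4C₁ : 0 ≤ 4 * C₁ * K / c₀ ^ B' := div_nonneg (mul_nonneg (mul_nonneg (by norm_num) hC₁0) hK0) hc₀B'pos.le
    by_cases hqs : (q : ℝ) ≤ Real.log (m x) ^ B'
    · -- small moduli: Siegel–Walfisz for `μ`
      have hqs' : (q : ℝ) ≤ Real.log (m' x) ^ B' :=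
        hqs.trans (Real.rpow_le_rpow (Real.log_nonneg hm1) (Real.log_le_log hmpos (by exact_mod_cast hmm'x)) hB'0.le)
      have h1m : (1 : ℝ) ≤ Real.log (m x) ^ B' := Real.one_le_rpow hlogm1 hB'0.le
      have h1m' : (1 : ℝ) ≤ Real.log (m' x) ^ B' := Real.one_le_rpow hlogm'1 hB'0.le
      -- the four Siegel–Walfisz bounds
      have s1 := hC₁ (m' x) hm'2 q hq hqs' (a : ZMod q) a.isUnit r hr0
      have s2 := hC₁ (m x) hm2 q hq hqs (a : ZMod q) a.isUnit r hr0
      have s3 := hC₁ (m' x) hm'2 1 le_rfl (by exact_mod_cast h1m') (0 : ZMod 1) (isUnit_of_subsingleton _) (q * r) hqr0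
      have s4 := hC₁ (m x) hm2 1 le_rfl (by exact_mod_cast h1m) (0 : ZMod 1) (isUnit_of_subsingleton _) (q * r) hqr0
      rw [Nat.floor_natCast] at s1 s2 s3 s4
      have f1 := hfrac (m' x) (by linarith) hm'Km hlogm'
      have f2 := hfrac (m x) hmpos.le hmKm hlogm
      rw [hA1', sum_Ioc_filter_eq_sub hmm'x]
      rw [hA2', sum_Ioc_filter_eq_sub hmm'x]
      have hpos1 : 0 ≤ (m' x : ℝ) / Real.log (m' x) ^ B' := by positivity
      have hpos2 : 0 ≤ (m x : ℝ) / Real.log (m x) ^ B' := by positivity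
      have h4r0 : 0 ≤ (4 : ℝ) ^ r.primeFactors.card := by positivity
      have h4qr0 : 0 ≤ (4 : ℝ) ^ (q * r).primeFactors.card := by positivity
      -- |A1|
      have bA1 : |∑ n ∈ (Icc 1 (m' x)).filter (fun n : ℕ => (n : ZMod q) = a ∧ n.Coprime r), (μ n : ℝ) -
          ∑ n ∈ (Icc 1 (m x)).filter (fun n : ℕ => (n : ZMod q) = a ∧ n.Coprime r), (μ n : ℝ)| ≤
          C₁ * 4 ^ r.primeFactors.card * (2 * (K / c₀ ^ B' * Y)) := by
        refine (abs_sub _ _).trans ?_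
        have t1 : C₁ * 4 ^ r.primeFactors.card * (m' x : ℝ) / Real.log (m' x) ^ B' ≤
            C₁ * 4 ^ r.primeFactors.card * (K / c₀ ^ B' * Y) := by
          rw [mul_div_assoc]; exact mul_le_mul_of_nonneg_left f1 (mul_nonneg hC₁0 h4r0)
        have t2 : C₁ * 4 ^ r.primeFactors.card * (m x : ℝ) / Real.log (m x) ^ B' ≤
            C₁ * 4 ^ r.primeFactors.card * (K / c₀ ^ B' * Y) := by
          rw [mul_div_assoc]; exact mul_le_mul_of_nonneg_left f2 (mul_nonneg hC₁0 h4r0)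
        linarith
      -- |A2|
      have bA2 : |∑ n ∈ (Icc 1 (m' x)).filter (fun n : ℕ => (n : ZMod 1) = 0 ∧ n.Coprime (q * r)), (μ n : ℝ) -
          ∑ n ∈ (Icc 1 (m x)).filter (fun n : ℕ => (n : ZMod 1) = 0 ∧ n.Coprime (q * r)), (μ n : ℝ)| ≤
          C₁ * 4 ^ (q * r).primeFactors.card * (2 * (K / c₀ ^ B' * Y)) := by
        refine (abs_sub _ _).trans ?_
        have t1 : C₁ * 4 ^ (q * r).primeFactors.card * (m' x : ℝ) / Real.log (m' x) ^ B' ≤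
            C₁ * 4 ^ (q * r).primeFactors.card * (K / c₀ ^ B' * Y) := by
          rw [mul_div_assoc]; exact mul_le_mul_of_nonneg_left f1 (mul_nonneg hC₁0 h4qr0)
        have t2 : C₁ * 4 ^ (q * r).primeFactors.card * (m x : ℝ) / Real.log (m x) ^ B' ≤
            C₁ * 4 ^ (q * r).primeFactors.card * (K / c₀ ^ B' * Y) := by
          rw [mul_div_assoc]; exact mul_le_mul_of_nonneg_left f2 (mul_nonneg hC₁0 h4qr0)
        linarith
      -- combine
      set V := |∑ n ∈ (Icc 1 (m' x)).filter (fun n : ℕ => (n : ZMod 1) = 0 ∧ n.Coprime (q * r)), (μ n : ℝ) -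
          ∑ n ∈ (Icc 1 (m x)).filter (fun n : ℕ => (n : ZMod 1) = 0 ∧ n.Coprime (q * r)), (μ n : ℝ)| with hV
      have hV0 : 0 ≤ V := abs_nonneg _
      have hVφ : V / Nat.totient q ≤ V := div_le_self hV0 hφ1
      have c1 : C₁ * 4 ^ r.primeFactors.card * (2 * (K / c₀ ^ B' * Y)) ≤ 2 * C₁ * K / c₀ ^ B' * X := by
        have := mul_le_mul_of_nonneg_left h4r (show 0 ≤ C₁ * (2 * (K / c₀ ^ B' * Y)) by positivity)
        rw [← hτkX]
        have e1 : C₁ * 4 ^ r.primeFactors.card * (2 * (K / c₀ ^ B' * Y)) = C₁ * (2 * (K / c₀ ^ B' * Y)) * 4 ^ r.primeFactors.card := by ring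
        have e2 : 2 * C₁ * K / c₀ ^ B' * ((σ 0 (q * r) : ℝ) ^ k * Y) = C₁ * (2 * (K / c₀ ^ B' * Y)) * (σ 0 (q * r) : ℝ) ^ k := by ring
        rw [e1, e2]; exact this
      have c2 : C₁ * 4 ^ (q * r).primeFactors.card * (2 * (K / c₀ ^ B' * Y)) ≤ 2 * C₁ * K / c₀ ^ B' * X := by
        have := mul_le_mul_of_nonneg_left h4qr (show 0 ≤ C₁ * (2 * (K / c₀ ^ B' * Y)) by positivity)
        rw [← hτkX]
        have e1 : C₁ * 4 ^ (q * r).primeFactors.card * (2 * (K / c₀ ^ B' * Y)) = C₁ * (2 * (K / c₀ ^ B' * Y)) * 4 ^ (q * r).primeFactors.card := by ring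
        have e2 : 2 * C₁ * K / c₀ ^ B' * ((σ 0 (q * r) : ℝ) ^ k * Y) = C₁ * (2 * (K / c₀ ^ B' * Y)) * (σ 0 (q * r) : ℝ) ^ k := by ring
        rw [e1, e2]; exact this
      rw [hCY]
      have hrest : 0 ≤ K / c₀ ^ B' * X + X + K * C₃ / c₀ ^ (B + 1) * X := by positivity
      have e4 : 4 * C₁ * K / c₀ ^ B' * X = 2 * C₁ * K / c₀ ^ B' * X + 2 * C₁ * K / c₀ ^ B' * X := by ring
      rw [e4]
      linarith
    · -- large moduli: trivial bounds
      rw [not_le] at hqs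
      have hL₀B'pos : 0 < L₀ ^ B' := Real.rpow_pos_of_pos hL₀ B'
      have hqL : L₀ ^ B' < q := lt_of_le_of_lt (Real.rpow_le_rpow hL₀.le hlogm hB'0.le) hqs
      have hqpos : (0 : ℝ) < q := by exact_mod_cast Nat.pos_of_ne_zero hq0
      -- |A1| ≤ m'/q + 1
      have bA1 : |A1| ≤ (m' x : ℝ) / q + 1 := by
        rw [hA1']
        refine (Finset.abs_sum_le_sum_abs _ _).trans ?_
        have h1 : ∑ n ∈ (Ioc (m x) (m' x)).filter (fun n : ℕ => (n : ZMod q) = a ∧ n.Coprime r), |(μ n : ℝ)| ≤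
            #((Ioc (m x) (m' x)).filter (fun n : ℕ => (n : ZMod q) = a ∧ n.Coprime r)) := by
          have := Finset.sum_le_card_nsmul ((Ioc (m x) (m' x)).filter (fun n : ℕ => (n : ZMod q) = a ∧ n.Coprime r))
            (fun n => |(μ n : ℝ)|) 1 (fun n _ => by exact_mod_cast ArithmeticFunction.abs_moebius_le_one)
          simpa using this
        have h2 : #((Ioc (m x) (m' x)).filter (fun n : ℕ => (n : ZMod q) = a ∧ n.Coprime r)) ≤
            #((range (m' x + 1)).filter fun n : ℕ => (n : ZMod q) = a) := by
          refine Finset.card_le_card fun n hn => ?_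
          simp only [Finset.mem_filter, Finset.mem_Ioc, Finset.mem_range] at hn ⊢
          exact ⟨by omega, hn.2.1⟩
        have h3 := card_range_filter_natCast_eq_le q (a : ZMod q) (m' x)
        have h4 : ((m' x / q + 1 : ℕ) : ℝ) ≤ (m' x : ℝ) / q + 1 := by
          have h4' : ((m' x / q : ℕ) : ℝ) ≤ (m' x : ℝ) / q := Nat.cast_div_le
          push_cast
          linarith
        calc _ ≤ (#((Ioc (m x) (m' x)).filter (fun n : ℕ => (n : ZMod q) = a ∧ n.Coprime r)) : ℝ) := h1
          _ ≤ ((m' x / q + 1 : ℕ) : ℝ) := by exact_mod_cast h2.trans h3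
          _ ≤ _ := h4
      -- |A2| ≤ m'
      have bA2 : |A2| ≤ (m' x : ℝ) := by
        rw [hA2']
        refine (Finset.abs_sum_le_sum_abs _ _).trans ?_
        have h1 := Finset.sum_le_card_nsmul ((Ioc (m x) (m' x)).filter
            (fun n : ℕ => (n : ZMod 1) = 0 ∧ n.Coprime (q * r))) (fun n => |(μ n : ℝ)|) 1
            (fun n _ => by exact_mod_cast ArithmeticFunction.abs_moebius_le_one)
        rw [nsmul_eq_mul, mul_one] at h1
        refine h1.trans ?_
        have h2 : #((Ioc (m x) (m' x)).filter (fun n : ℕ => (n : ZMod 1) = 0 ∧ n.Coprime (q * r))) ≤ m' x :=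
          (Finset.card_filter_le _ _).trans (by simp)
        exact_mod_cast h2
      -- `1/φ(q) ≤ C₃/√q ≤ C₃ / L₀^{B+1}`
      have hsqrtpos : 0 < Real.sqrt q := Real.sqrt_pos.2 hqpos
      have hinvφ : 1 / (Nat.totient q : ℝ) ≤ C₃ / Real.sqrt q := by
        rw [div_le_div_iff₀ hφ0 hsqrtpos]
        have := hC₃ q hq0
        linarith
      have hsqrtq : L₀ ^ (B + 1) ≤ Real.sqrt q := by
        have e : L₀ ^ (B + 1) = Real.sqrt (L₀ ^ B') := by
          rw [Real.sqrt_eq_rpow, ← Real.rpow_mul hL₀.le, hB']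
          congr 1
          ring
        rw [e]
        exact Real.sqrt_le_sqrt hqL.le
      have hL₀B1pos : 0 < L₀ ^ (B + 1) := Real.rpow_pos_of_pos hL₀ _
      -- term bounds
      have t1 : (m' x : ℝ) / q ≤ K / c₀ ^ B' * Y := by
        calc (m' x : ℝ) / q ≤ (m' x : ℝ) / L₀ ^ B' := div_le_div_of_nonneg_left (by linarith) hL₀B'pos hqL.le
          _ ≤ K * m x / L₀ ^ B' := div_le_div_of_nonneg_right hm'Km hL₀B'pos.le
          _ = K / c₀ ^ B' * (m x / Real.log x ^ B') := by rw [hL₀B']; field_simp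
          _ ≤ K / c₀ ^ B' * Y := mul_le_mul_of_nonneg_left AUX3 hKc
      have t3 : |A2| / Nat.totient q ≤ K * C₃ / c₀ ^ (B + 1) * Y := by
        calc |A2| / Nat.totient q = |A2| * (1 / Nat.totient q) := by ring
          _ ≤ (K * m x) * (C₃ / Real.sqrt q) :=
              mul_le_mul (bA2.trans hm'Km) hinvφ (by positivity) (mul_nonneg hK0 hmpos.le)
          _ ≤ (K * m x) * (C₃ / L₀ ^ (B + 1)) :=
              mul_le_mul_of_nonneg_left (div_le_div_of_nonneg_left hC₃0 hL₀B1pos hsqrtq) (mul_nonneg hK0 hmpos.le)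
          _ = K * C₃ / c₀ ^ (B + 1) * (m x / Real.log x ^ (B + 1)) := by rw [hL₀B1]; field_simp
          _ ≤ K * C₃ / c₀ ^ (B + 1) * Y := mul_le_mul_of_nonneg_left AUX2 hKC₃c
      rw [hCY]
      have u1 : K / c₀ ^ B' * Y ≤ K / c₀ ^ B' * X := mul_le_mul_of_nonneg_left hYX' hKc
      have u3 : K * C₃ / c₀ ^ (B + 1) * Y ≤ K * C₃ / c₀ ^ (B + 1) * X := mul_le_mul_of_nonneg_left hYX' hKC₃c
      have u0 : 0 ≤ 4 * C₁ * K / c₀ ^ B' * X := mul_nonneg h4C₁ hX0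
      linarith
  -- assemble
  rw [hΔ]
  calc |A1 - A2 / Nat.totient q| ≤ |A1| + |A2| / Nat.totient q := by
        rw [← abs_of_pos hφ0, ← abs_div, abs_of_pos hφ0]
        exact abs_sub _ _
    _ ≤ _ := hbound
    _ = _ := by ring

end Literature.NumberTheory.Sieve
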